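import Literature.NumberTheory.LFunctions.SoundTestFunction
import Literature.NumberTheory.LFunctions.WeilSemilocalCompactnessProofs
import Literature.Analysis.SpecialFunctions.DigammaVerticalSeries
import Literature.Analysis.SpecialFunctions.DigammaGauss
import Mathlib.Analysis.Fourier.Inversion
import HarnessLib

/-!
# The archimedean term of the explicit formula for `g_z = e^{−(z−½)|y|}(log x − |y|)₊`

Topic `Literature/NumberTheory/LFunctions`. Everything in this file is PROVED (no definitions of
notions, no named facts). Continuation of `SoundTestFunction.lean` on the way to Soundararajan's
main lemma (M. Balazard, A. de Roton, arXiv:0810.3587, Prop. 5) through the Guinand–Weil explicit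
formula: sizes of `Ψ_L` and of `ĝ(½ + iτ)`, the integrability hypotheses of
`Literature.NumberTheory.LFunctions.explicit_formula_continuous` for `g = SoundTest.test c L`, and
(in the sequel) the evaluation `Re W_∞(g) = L log t + O(L)` of the archimedean term.

## References

* [BalazardDeRoton2008] M. Balazard, A. de Roton, arXiv:0810.3587, Props. 3–5. [cite: BalazardDeRoton2008, Prop. 5 (proof)]
-/

noncomputable section

open Complex Filter Set MeasureTheory Topology intervalIntegral
open scoped Real

namespace Literature.NumberTheory.LFunctions

namespace SoundTest

open Literature.Analysis.SpecialFunctions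

/-! ## Sizes of `Ψ_L(a)` -/

/-- `‖Ψ_L(a)‖ ≤ L²/2` for `Re a ≤ 0` (`|e^{ay}| ≤ 1` on `[0, L]`). [folklore] -/
theorem norm_psiInt_le_sq {L : ℝ} (hL : 0 ≤ L) {a : ℂ} (ha : a.re ≤ 0) : ‖psiInt L a‖ ≤ L ^ 2 / 2 := by
  unfold psiInt
  have hbound : ∀ y ∈ Set.Ioc 0 L, ‖((L - y : ℝ) : ℂ) * Complex.exp (a * y)‖ ≤ L - y := by
    intro y hy
    rw [norm_mul, Complex.norm_real, Real.norm_eq_abs, abs_of_nonneg (by linarith [hy.2]), Complex.norm_exp]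
    have : (a * (y : ℂ)).re = a.re * y := by simp
    rw [this]
    have h1 : Real.exp (a.re * y) ≤ 1 := Real.exp_le_one_iff.2 (mul_nonpos_of_nonpos_of_nonneg ha hy.1.le)
    calc (L - y) * Real.exp (a.re * y) ≤ (L - y) * 1 := by
          exact mul_le_mul_of_nonneg_left h1 (by linarith [hy.2])
      _ = L - y := mul_one _
  calc ‖∫ y in (0 : ℝ)..L, ((L - y : ℝ) : ℂ) * Complex.exp (a * y)‖
      ≤ ∫ y in (0 : ℝ)..L, (L - y) := by
        exact intervalIntegral.norm_integral_le_of_norm_le hL (Eventually.of_forall hbound)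
          ((continuous_const.sub continuous_id).intervalIntegrable _ _)
    _ = L ^ 2 / 2 := by
        rw [integral_sub intervalIntegrable_const intervalIntegral.intervalIntegrable_id, intervalIntegral.integral_const,
          integral_id]
        simp only [smul_eq_mul]; ring

/-- `‖Ψ_L(a)‖ ≤ (2 + ‖a‖ L)/‖a‖²` for `a ≠ 0`, `Re a ≤ 0` (closed form). [folklore] -/
theorem norm_psiInt_le_inv {L : ℝ} (hL : 0 ≤ L) {a : ℂ} (ha : a ≠ 0) (ha' : a.re ≤ 0) :
    ‖psiInt L a‖ ≤ (2 + ‖a‖ * L) / ‖a‖ ^ 2 := by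
  rw [psiInt_eq ha, norm_div, norm_pow]
  refine div_le_div_of_nonneg_right ?_ (by positivity)
  have h1 : ‖Complex.exp (a * L)‖ ≤ 1 := by
    rw [Complex.norm_exp]
    have : (a * (L : ℂ)).re = a.re * L := by simp
    rw [this]; exact Real.exp_le_one_iff.2 (mul_nonpos_of_nonpos_of_nonneg ha' hL)
  calc ‖Complex.exp (a * L) - 1 - a * L‖ ≤ ‖Complex.exp (a * L)‖ + ‖(1 : ℂ)‖ + ‖a * L‖ := by
        have := norm_sub_le (Complex.exp (a * L) - 1) (a * L)
        have := norm_sub_le (Complex.exp (a * L)) 1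
        linarith
    _ ≤ 1 + 1 + ‖a‖ * L := by
        rw [norm_one, norm_mul, Complex.norm_real, Real.norm_eq_abs, abs_of_nonneg hL]; linarith
    _ = 2 + ‖a‖ * L := by ring

/-! ## `ĝ` on the critical line -/

/-- On the critical line: `ĝ(½ + iτ) = Ψ(iτ − c) + Ψ(−iτ − c)`. [folklore] -/
theorem weilMellin_test_half (c : ℂ) {L : ℝ} (hL : 0 ≤ L) (τ : ℝ) :
    weilMellin (test c L) (1 / 2 + τ * I) = psiInt L (τ * I - c) + psiInt L (-(τ * I) - c) := by
  rw [weilMellin_test c hL]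
  congr 2 <;> ring

/-- The pairing identity: for `a, b ≠ 0`,
`Ψ(a) + Ψ(b) = (e^{aL}/a² + e^{bL}/b²) − (1/a² + 1/b²) − L (a + b)/(ab)`. [folklore] -/
theorem psiInt_add_psiInt {L : ℝ} {a b : ℂ} (ha : a ≠ 0) (hb : b ≠ 0) :
    psiInt L a + psiInt L b =
      (Complex.exp (a * L) / a ^ 2 + Complex.exp (b * L) / b ^ 2) - (1 / a ^ 2 + 1 / b ^ 2)
        - (L : ℂ) * (a + b) / (a * b) := by
  rw [psiInt_eq ha, psiInt_eq hb]
  field_simp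
  ring

/-- **Tail bound on the critical line**: for `0 ≤ Re c`, `L ≥ 0` and `|τ| ≥ 2‖c‖ + 2`,
`‖ĝ(½ + iτ)‖ ≤ (16 + 8 L ‖c‖)/τ²`. [folklore] -/
theorem norm_weilMellin_test_half_le_tail {c : ℂ} (hc : 0 ≤ c.re) {L : ℝ} (hL : 0 ≤ L) {τ : ℝ}
    (hτ : 2 * ‖c‖ + 2 ≤ |τ|) :
    ‖weilMellin (test c L) (1 / 2 + τ * I)‖ ≤ (16 + 8 * L * ‖c‖) / τ ^ 2 := by
  rw [weilMellin_test_half c hL]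
  set a : ℂ := τ * I - c with ha
  set b : ℂ := -(τ * I) - c with hb
  have hτ0 : 0 < |τ| := by linarith [norm_nonneg c]
  -- `|a|, |b| ≥ |τ|/2`
  have hnI : ‖(τ : ℂ) * I‖ = |τ| := by simp
  have haτ : |τ| / 2 ≤ ‖a‖ := by
    have h1 : ‖(τ : ℂ) * I‖ ≤ ‖a‖ + ‖c‖ := by
      have := norm_sub_le ((τ : ℂ) * I - c + c) c
      simp only [add_sub_cancel_right] at this
      calc ‖(τ : ℂ) * I‖ = ‖(τ * I - c) + c‖ := by ring_nf
        _ ≤ ‖τ * I - c‖ + ‖c‖ := norm_add_le _ _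
    rw [hnI] at h1
    linarith
  have hbτ : |τ| / 2 ≤ ‖b‖ := by
    have h1 : ‖-((τ : ℂ) * I)‖ ≤ ‖b‖ + ‖c‖ := by
      calc ‖-((τ : ℂ) * I)‖ = ‖(-(τ * I) - c) + c‖ := by ring_nf
        _ ≤ ‖-(τ * I) - c‖ + ‖c‖ := norm_add_le _ _
    rw [norm_neg, hnI] at h1
    linarith
  have ha0 : a ≠ 0 := fun h ↦ by rw [h, norm_zero] at haτ; linarith
  have hb0 : b ≠ 0 := fun h ↦ by rw [h, norm_zero] at hbτ; linarith
  have hare : a.re ≤ 0 := by simp [ha]; linarith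
  have hbre : b.re ≤ 0 := by simp [hb]; linarith
  rw [psiInt_add_psiInt ha0 hb0]
  have hab : a + b = -2 * c := by rw [ha, hb]; ring
  -- bound each piece
  have hea : ‖Complex.exp (a * L)‖ ≤ 1 := by
    rw [Complex.norm_exp]; refine Real.exp_le_one_iff.2 ?_
    have : (a * (L : ℂ)).re = a.re * L := by simp
    rw [this]; exact mul_nonpos_of_nonpos_of_nonneg hare hL
  have heb : ‖Complex.exp (b * L)‖ ≤ 1 := by
    rw [Complex.norm_exp]; refine Real.exp_le_one_iff.2 ?_
    have : (b * (L : ℂ)).re = b.re * L := by simp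
    rw [this]; exact mul_nonpos_of_nonpos_of_nonneg hbre hL
  have ha2 : τ ^ 2 / 4 ≤ ‖a‖ ^ 2 := by
    have := pow_le_pow_left₀ (by positivity) haτ 2
    rw [div_pow, sq_abs] at this; norm_num at this; linarith
  have hb2 : τ ^ 2 / 4 ≤ ‖b‖ ^ 2 := by
    have := pow_le_pow_left₀ (by positivity) hbτ 2
    rw [div_pow, sq_abs] at this; norm_num at this; linarith
  have hτ2 : 0 < τ ^ 2 := by rw [← sq_abs]; exact pow_pos hτ0 2
  have h1 : ‖Complex.exp (a * L) / a ^ 2 + Complex.exp (b * L) / b ^ 2‖ ≤ 8 / τ ^ 2 := by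
    calc ‖Complex.exp (a * L) / a ^ 2 + Complex.exp (b * L) / b ^ 2‖
        ≤ ‖Complex.exp (a * L)‖ / ‖a‖ ^ 2 + ‖Complex.exp (b * L)‖ / ‖b‖ ^ 2 := by
          refine (norm_add_le _ _).trans ?_
          rw [norm_div, norm_div, norm_pow, norm_pow]
      _ ≤ 1 / (τ ^ 2 / 4) + 1 / (τ ^ 2 / 4) := by
          gcongr
      _ = 8 / τ ^ 2 := by field_simp; ring
  have h2 : ‖(1 / a ^ 2 + 1 / b ^ 2 : ℂ)‖ ≤ 8 / τ ^ 2 := by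
    calc ‖(1 / a ^ 2 + 1 / b ^ 2 : ℂ)‖ ≤ 1 / ‖a‖ ^ 2 + 1 / ‖b‖ ^ 2 := by
          refine (norm_add_le _ _).trans ?_
          rw [norm_div, norm_div, norm_one, norm_pow, norm_pow]
      _ ≤ 1 / (τ ^ 2 / 4) + 1 / (τ ^ 2 / 4) := by gcongr
      _ = 8 / τ ^ 2 := by field_simp; ring
  have h3 : ‖(L : ℂ) * (a + b) / (a * b)‖ ≤ 8 * L * ‖c‖ / τ ^ 2 := by
    rw [hab, norm_div, norm_mul, norm_mul, Complex.norm_real, Real.norm_eq_abs, abs_of_nonneg hL, norm_mul,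
      norm_neg, Complex.norm_ofNat]
    rw [div_le_div_iff₀ (by positivity) hτ2]
    have : τ ^ 2 / 4 ≤ ‖a‖ * ‖b‖ := by
      calc τ ^ 2 / 4 = (|τ| / 2) * (|τ| / 2) := by rw [← sq_abs]; ring
        _ ≤ ‖a‖ * ‖b‖ := mul_le_mul haτ hbτ (by positivity) (norm_nonneg _)
    have h4 := mul_le_mul_of_nonneg_left this (by positivity : 0 ≤ L * ‖c‖)
    linarith [h4]
  calc ‖Complex.exp (a * L) / a ^ 2 + Complex.exp (b * L) / b ^ 2 - (1 / a ^ 2 + 1 / b ^ 2) -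
        (L : ℂ) * (a + b) / (a * b)‖
      ≤ ‖Complex.exp (a * L) / a ^ 2 + Complex.exp (b * L) / b ^ 2‖ + ‖(1 / a ^ 2 + 1 / b ^ 2 : ℂ)‖ +
          ‖(L : ℂ) * (a + b) / (a * b)‖ := by
        have e1 := norm_sub_le (Complex.exp (a * L) / a ^ 2 + Complex.exp (b * L) / b ^ 2 - (1 / a ^ 2 + 1 / b ^ 2))
          ((L : ℂ) * (a + b) / (a * b))
        have e2 := norm_sub_le (Complex.exp (a * L) / a ^ 2 + Complex.exp (b * L) / b ^ 2) (1 / a ^ 2 + 1 / b ^ 2 : ℂ)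
        linarith
    _ ≤ 8 / τ ^ 2 + 8 / τ ^ 2 + 8 * L * ‖c‖ / τ ^ 2 := by linarith
    _ = (16 + 8 * L * ‖c‖) / τ ^ 2 := by field_simp; ring

/-- **Global bound on the critical line**: `‖ĝ(½ + iτ)‖ ≤ L²` (`Re c ≥ 0`, `L ≥ 0`). [folklore] -/
theorem norm_weilMellin_test_half_le_sq {c : ℂ} (hc : 0 ≤ c.re) {L : ℝ} (hL : 0 ≤ L) (τ : ℝ) :
    ‖weilMellin (test c L) (1 / 2 + τ * I)‖ ≤ L ^ 2 := by
  rw [weilMellin_test_half c hL]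
  have h1 := norm_psiInt_le_sq hL (a := τ * I - c) (by simp; linarith)
  have h2 := norm_psiInt_le_sq hL (a := -(τ * I) - c) (by simp; linarith)
  linarith [norm_add_le (psiInt L (τ * I - c)) (psiInt L (-(τ * I) - c))]

/-- **Integrability of `ĝ` on the critical line.** [folklore] -/
theorem integrable_weilMellin_test_half {c : ℂ} (hc : 0 ≤ c.re) {L : ℝ} (hL : 0 ≤ L) :
    Integrable fun τ : ℝ ↦ weilMellin (test c L) (1 / 2 + τ * I) := by
  set T₀ : ℝ := 2 * ‖c‖ + 2 with hT₀
  set K : ℝ := max (L ^ 2 * (1 + T₀ ^ 2)) (2 * (16 + 8 * L * ‖c‖)) with hK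
  have hcont : Continuous fun τ : ℝ ↦ weilMellin (test c L) (1 / 2 + τ * I) :=
    (continuous_weilMellin (continuous_test c L) (hasCompactSupport_test c L)).comp (by fun_prop)
  refine Integrable.mono' ((integrable_inv_one_add_sq).const_mul K) hcont.aestronglyMeasurable
    (Eventually.of_forall fun τ ↦ ?_)
  by_cases hτ : |τ| ≤ T₀
  · -- compact part: `L² ≤ K/(1+τ²)`
    have h1 := norm_weilMellin_test_half_le_sq hc hL τ
    have hτ2 : τ ^ 2 ≤ T₀ ^ 2 := by rw [← sq_abs]; exact pow_le_pow_left₀ (abs_nonneg τ) hτ 2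
    have hK1 : L ^ 2 * (1 + T₀ ^ 2) ≤ K := le_max_left _ _
    rw [le_mul_inv_iff₀ (by positivity)]
    calc ‖weilMellin (test c L) (1 / 2 + τ * I)‖ * (1 + τ ^ 2) ≤ L ^ 2 * (1 + T₀ ^ 2) := by
          gcongr
      _ ≤ K := hK1
  · rw [not_le] at hτ
    have h1 := norm_weilMellin_test_half_le_tail hc hL hτ.le
    have hK2 : 2 * (16 + 8 * L * ‖c‖) ≤ K := le_max_right _ _
    have hτ1 : 1 ≤ τ ^ 2 := by
      have : 1 ≤ |τ| := by linarith [norm_nonneg c]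
      rw [← sq_abs]; nlinarith
    refine h1.trans ?_
    have hA : 0 ≤ 16 + 8 * L * ‖c‖ := by positivity
    calc (16 + 8 * L * ‖c‖) / τ ^ 2 ≤ 2 * (16 + 8 * L * ‖c‖) / (1 + τ ^ 2) := by
          rw [div_le_div_iff₀ (by positivity) (by positivity)]; nlinarith [hA, hτ1]
      _ ≤ K / (1 + τ ^ 2) := by gcongr
      _ = K * (1 + τ ^ 2)⁻¹ := div_eq_mul_inv _ _

/-! ## The weight `R(τ) = Re ψ(¼ + iτ/2)` -/

/-- **Stirling on the quarter line**: `|Re ψ(¼ + iτ/2) − log(τ/2)| ≤ 5/τ` for `τ ≥ 1`. [folklore] -/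
theorem abs_reDigammaQuarter_sub_log_le {τ : ℝ} (hτ : 1 ≤ τ) :
    |reDigammaQuarter τ - Real.log (τ / 2)| ≤ 5 / τ := by
  set w : ℂ := 1 / 4 + τ / 2 * I with hw
  have hwre : w.re = 1 / 4 := by simp [hw]
  have hwim : w.im = τ / 2 := by simp [hw]
  have hτ0 : 0 < τ := by linarith
  have h1 := Literature.Analysis.SpecialFunctions.Complex.abs_re_digamma_sub_log_norm_le
    (w := w) (by rw [hwre]; norm_num) (by rw [hwim]; linarith)
  have hR : reDigammaQuarter τ = (Complex.digamma w).re := rfl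
  -- `‖w‖ ≥ τ/2` and `‖w‖² = 1/16 + τ²/4`
  have hnormsq : ‖w‖ ^ 2 = 1 / 16 + τ ^ 2 / 4 := by
    rw [Complex.sq_norm, Complex.normSq_apply, hwre, hwim]; ring
  have hnorm_ge : τ / 2 ≤ ‖w‖ := by
    have := Complex.abs_im_le_norm w
    rwa [hwim, abs_of_pos (by linarith)] at this
  have hnorm_pos : 0 < ‖w‖ := by linarith
  -- `0 ≤ log ‖w‖ − log(τ/2) ≤ 1/(8τ²)`
  have hlog_lo : Real.log (τ / 2) ≤ Real.log ‖w‖ := Real.log_le_log (by linarith) hnorm_ge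
  have hlog_hi : Real.log ‖w‖ ≤ Real.log (τ / 2) + 1 / (8 * τ ^ 2) := by
    have h2 : Real.log ‖w‖ = Real.log (‖w‖ ^ 2) / 2 := by
      rw [Real.log_pow]; push_cast; ring
    have h3 : Real.log (τ / 2) = Real.log ((τ / 2) ^ 2) / 2 := by
      rw [Real.log_pow]; push_cast; ring
    rw [h2, h3, hnormsq]
    have h4 : Real.log (1 / 16 + τ ^ 2 / 4) ≤ Real.log ((τ / 2) ^ 2) + 1 / (4 * τ ^ 2) := by
      have h5 : 1 / 16 + τ ^ 2 / 4 = (τ / 2) ^ 2 * (1 + 1 / (4 * τ ^ 2)) := by field_simp; ring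
      rw [h5, Real.log_mul (by positivity) (by positivity)]
      have := Real.log_le_sub_one_of_pos (show 0 < 1 + 1 / (4 * τ ^ 2) by positivity)
      linarith
    have : 1 / (4 * τ ^ 2) / 2 = 1 / (8 * τ ^ 2) := by ring
    linarith [this]
  -- combine
  have hb1 : 1 / (2 * ‖w‖ ^ 2) ≤ 2 / τ := by
    rw [div_le_div_iff₀ (by positivity) hτ0]
    have : τ ^ 2 / 4 ≤ ‖w‖ ^ 2 := by rw [hnormsq]; linarith
    nlinarith
  have hb2 : π / (4 * |w.im|) ≤ 2 / τ := by
    rw [hwim, abs_of_pos (by linarith), div_le_div_iff₀ (by positivity) hτ0]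
    nlinarith [Real.pi_lt_four]
  have hb3 : 1 / (8 * τ ^ 2) ≤ 1 / τ := by
    rw [div_le_div_iff₀ (by positivity) hτ0]; nlinarith
  rw [hR]
  have := abs_le.1 (h1.trans (add_le_add hb1 hb2))
  set ι : ℝ := 1 / τ with hι
  have hι0 : 0 ≤ ι := by positivity
  have e2 : 2 / τ = 2 * ι := by rw [hι]; ring
  have e5 : 5 / τ = 5 * ι := by rw [hι]; ring
  rw [e2] at this
  rw [e5, abs_le]
  obtain ⟨hlo, hhi⟩ := this
  constructor <;> linarith

/-- **A global bound for the weight**: `|Re ψ(¼ + iτ/2)| ≤ C + log(1 + |τ|)`. [folklore] -/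
theorem exists_abs_reDigammaQuarter_le :
    ∃ C : ℝ, 0 ≤ C ∧ ∀ τ : ℝ, |reDigammaQuarter τ| ≤ C + Real.log (1 + |τ|) := by
  refine ⟨|reDigammaQuarter 0| + 6, by positivity, fun τ ↦ ?_⟩
  have hlog0 : 0 ≤ Real.log (1 + |τ|) := Real.log_nonneg (by linarith [abs_nonneg τ])
  -- reduce to `τ ≥ 0` by evenness
  wlog hτ : 0 ≤ τ generalizing τ
  · have := this (-τ) (by rwa [abs_neg]) (by linarith)
    rwa [reDigammaQuarter_even, abs_neg] at this
  rw [abs_of_nonneg hτ] at hlog0 ⊢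
  by_cases h1 : τ ≤ 1
  · -- `R(0) ≤ R(τ) ≤ R(1)` and `|R(1)| ≤ |log(1/2)| + 5`
    have hlo := reDigammaQuarter_zero_le τ
    have hhi : reDigammaQuarter τ ≤ reDigammaQuarter 1 :=
      reDigammaQuarter_mono (by rw [abs_of_nonneg hτ, abs_one]; exact h1)
    have h1b := abs_le.1 (abs_reDigammaQuarter_sub_log_le le_rfl)
    have hl2 : |Real.log (1 / 2)| ≤ 1 := by
      rw [one_div, Real.log_inv, abs_neg, abs_of_nonneg (Real.log_nonneg (by norm_num))]
      have := Real.log_two_lt_d9; linarith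
    have := abs_le.1 hl2
    rw [abs_le]; constructor <;> linarith [le_abs_self (reDigammaQuarter 0), neg_abs_le (reDigammaQuarter 0)]
  · rw [not_le] at h1
    have h2 := abs_le.1 (abs_reDigammaQuarter_sub_log_le h1.le)
    have h5 : 5 / τ ≤ 5 := by rw [div_le_iff₀ (by linarith)]; linarith
    -- `|log(τ/2)| ≤ log(1+τ) + 1`
    have hl : |Real.log (τ / 2)| ≤ Real.log (1 + τ) + 1 := by
      have hup : Real.log (τ / 2) ≤ Real.log (1 + τ) := Real.log_le_log (by linarith) (by linarith)
      have hdown : -1 ≤ Real.log (τ / 2) := by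
        have : Real.log (1 / 2) ≤ Real.log (τ / 2) := Real.log_le_log (by norm_num) (by linarith)
        rw [one_div, Real.log_inv] at this
        have := Real.log_two_lt_d9; linarith
      rw [abs_le]; constructor <;> linarith
    have := abs_le.1 hl
    rw [abs_le]; constructor <;> linarith [abs_nonneg (reDigammaQuarter 0)]

/-! ## The archimedean integrability hypothesis `hA` -/

/-- **`τ ↦ ĝ(½ + iτ) · Re ψ(¼ + iτ/2)` is integrable** (`Re c ≥ 0`, `L ≥ 0`): the hypothesis `hA`
of `explicit_formula_continuous` for `g = SoundTest.test c L`. [folklore] -/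
theorem integrable_weilMellin_test_mul_reDigamma {c : ℂ} (hc : 0 ≤ c.re) {L : ℝ} (hL : 0 ≤ L) :
    Integrable fun τ : ℝ ↦ weilMellin (test c L) (1 / 2 + τ * I) *
      ((Complex.digamma (1 / 4 + τ / 2 * I)).re : ℂ) := by
  obtain ⟨C, hC0, hC⟩ := exists_abs_reDigammaQuarter_le
  set T₀ : ℝ := 2 * ‖c‖ + 2 with hT₀
  set K : ℝ := max (L ^ 2 * (1 + T₀ ^ 2)) (2 * (16 + 8 * L * ‖c‖)) with hK
  have hK0 : 0 ≤ K := le_max_of_le_left (by positivity)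
  -- `‖ĝ(½+iτ)‖ ≤ K/(1+τ²)` (as in `integrable_weilMellin_test_half`)
  have hgb : ∀ τ : ℝ, ‖weilMellin (test c L) (1 / 2 + τ * I)‖ ≤ K / (1 + τ ^ 2) := by
    intro τ
    by_cases hτ : |τ| ≤ T₀
    · have h1 := norm_weilMellin_test_half_le_sq hc hL τ
      have hτ2 : τ ^ 2 ≤ T₀ ^ 2 := by rw [← sq_abs]; exact pow_le_pow_left₀ (abs_nonneg τ) hτ 2
      rw [le_div_iff₀ (by positivity)]
      calc ‖weilMellin (test c L) (1 / 2 + τ * I)‖ * (1 + τ ^ 2) ≤ L ^ 2 * (1 + T₀ ^ 2) := by gcongr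
        _ ≤ K := le_max_left _ _
    · rw [not_le] at hτ
      have h1 := norm_weilMellin_test_half_le_tail hc hL hτ.le
      have hτ1 : 1 ≤ τ ^ 2 := by
        have : 1 ≤ |τ| := by linarith [norm_nonneg c]
        rw [← sq_abs]; nlinarith
      refine h1.trans ?_
      have hA : 0 ≤ 16 + 8 * L * ‖c‖ := by positivity
      calc (16 + 8 * L * ‖c‖) / τ ^ 2 ≤ 2 * (16 + 8 * L * ‖c‖) / (1 + τ ^ 2) := by
            rw [div_le_div_iff₀ (by positivity) (by positivity)]; nlinarith [hA, hτ1]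
        _ ≤ K / (1 + τ ^ 2) := by gcongr; exact le_max_right _ _
  -- continuity
  have hcont : Continuous fun τ : ℝ ↦ weilMellin (test c L) (1 / 2 + τ * I) *
      ((Complex.digamma (1 / 4 + τ / 2 * I)).re : ℂ) := by
    refine ((continuous_weilMellin (continuous_test c L) (hasCompactSupport_test c L)).comp (by fun_prop)).mul ?_
    exact Complex.continuous_ofReal.comp continuous_reDigammaQuarter
  -- domination by `K (C + 2) (1 + |τ|)^{-3/2} · 4`
  have hdom : Integrable fun τ : ℝ ↦ 4 * K * (C + 2) * (1 + ‖τ‖) ^ (-(3 / 2 : ℝ)) :=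
    ((integrable_one_add_norm (E := ℝ) (μ := volume) (r := 3 / 2) (by simp; norm_num)).const_mul _)
  refine Integrable.mono' hdom hcont.aestronglyMeasurable (Eventually.of_forall fun τ ↦ ?_)
  rw [norm_mul, Complex.norm_real, Real.norm_eq_abs, Real.norm_eq_abs]
  have hR := hC τ
  have hg := hgb τ
  -- `log(1+|τ|) ≤ 2 (1+|τ|)^{1/2}` and `1 + τ² ≥ (1+|τ|)²/2`
  set y : ℝ := 1 + |τ| with hy
  have hy1 : 1 ≤ y := by rw [hy]; linarith [abs_nonneg τ]
  have hlog : Real.log y ≤ 2 * Real.sqrt y := by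
    have h1 : Real.log (Real.sqrt y) ≤ Real.sqrt y - 1 := Real.log_le_sub_one_of_pos (Real.sqrt_pos.2 (by linarith))
    rw [Real.log_sqrt (by linarith)] at h1
    linarith
  have hsq : (1 + |τ|) ^ 2 ≤ 2 * (1 + τ ^ 2) := by
    nlinarith [sq_nonneg (|τ| - 1), sq_abs τ, abs_nonneg τ]
  have hpow : y ^ (-(3 / 2 : ℝ)) = 1 / (y * Real.sqrt y) := by
    rw [Real.rpow_neg (by linarith), one_div]
    congr 1
    rw [show (3 / 2 : ℝ) = 1 + 1 / 2 by norm_num, Real.rpow_add (by linarith), Real.rpow_one, Real.sqrt_eq_rpow]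
  rw [hpow]
  have hyy : 0 < y * Real.sqrt y := by positivity
  have hlogy0 : 0 ≤ Real.log y := Real.log_nonneg hy1
  calc ‖weilMellin (test c L) (1 / 2 + τ * I)‖ * |(Complex.digamma (1 / 4 + τ / 2 * I)).re|
      ≤ K / (1 + τ ^ 2) * (C + Real.log y) := by
        gcongr
        exact hR
    _ ≤ K / (y ^ 2 / 2) * (C + 2 * Real.sqrt y) := by
        have hy2 : y ^ 2 / 2 ≤ 1 + τ ^ 2 := by rw [hy]; linarith [hsq]
        gcongr
    _ = 2 * K * (C + 2 * Real.sqrt y) / y ^ 2 := by field_simp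
    _ ≤ 4 * K * (C + 2) * (1 / (y * Real.sqrt y)) := by
        rw [div_le_iff₀ (by positivity), mul_one_div, div_mul_eq_mul_div, le_div_iff₀ hyy]
        -- `2K(C + 2√y) · y√y ≤ 4K(C+2) · y²`, i.e. `(C + 2√y)√y ≤ 2(C+2) y`
        have hs1 : 1 ≤ Real.sqrt y := by rw [Real.le_sqrt (by norm_num) (by linarith)]; linarith
        have hs2 : Real.sqrt y * Real.sqrt y = y := Real.mul_self_sqrt (by linarith)
        have hsy : Real.sqrt y ≤ y := by nlinarith [hs1, hs2]
        have key : (C + 2 * Real.sqrt y) * Real.sqrt y ≤ 2 * (C + 2) * y := by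
          have := mul_le_mul_of_nonneg_left hsy hC0
          nlinarith [this, hs2, hC0, hs1]
        have := mul_le_mul_of_nonneg_left key (by positivity : 0 ≤ 2 * K * y)
        nlinarith [this]

end SoundTest

end Literature.NumberTheory.LFunctions
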